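import Literature.NumberTheory.QuadraticFields.ThreeTorsionMeanProgressionCubicCount
import Mathlib.NumberTheory.DirichletCharacter.Orthogonality
import Mathlib.NumberTheory.DirichletCharacter.Bounds
import HarnessLib

/-!
# Taniguchi–Thorne §6.4–§6.6: progressions through Dirichlet characters — "we readily deduce Theorem 6" (proofs)

Theorems-only companion (no definition, no named fact, no instance; D-0026) of
`Literature.NumberTheory.QuadraticFields.ThreeTorsionMean` (`tt_threeTorsion_sum_progression`,
Taniguchi–Thorne 2013, Thm 6), continuing `ThreeTorsionMeanProgressionCubicCount.lean` (Thm 6 at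
`(m, a)` ⟺ the two-term asymptotic for `M₃^±(X; m, a) = Σ_{0<±D<X, D ≡ a (m)} c(D)`, `c(D)` the
number of nowhere totally ramified cubic fields of discriminant `D`, abstractly any `c` with
`#Cl₃(D) = 2·c(D) + 1`).

Taniguchi–Thorne, §6.4 (arXiv p. 23): "As in prime number theory, we can approach this question
by twisting by Dirichlet characters. If `χ` is a Dirichlet character `(mod m)`, write
`N₃^±(X, χ) := Σ_{[K:ℚ]=3, 0<±Disc(K)<X} χ(Disc(K))`. Then if `(a, m) = 1`, we have the usual
orthogonality relation
`N₃^±(X; m, a) = (1/φ(m)) Σ_{χ (mod m)} χ̄(a) N₃^±(X, χ)`."  §6.6 (pp. 27–28): the same for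
the nowhere-totally-ramified count `M₃^±`, Theorem 25 (for `χ⁶ ≠ 1` only an error term
`O(X^{18/23+ε} N^{20/23})`; for `χ⁶ = 1` a main term `δ(χ) C'^±(𝒮)/(2π²) X`, `δ(χ) = [χ trivial]`,
plus a `X^{5/6}`-term, local densities normalised "by dividing by `1 + p⁻¹`"), then
"`M₃^±(X; m, a) = C'₁(m, a) (C^±/(2π²)) X + K'₁(m, a) (4K^±/(5Γ(2/3)³)) X^{5/6}` … If
`(a, 6m) = 1`, then `C'₁(m, a) = (1/m) Π_{p ∣ m} (1 - p⁻²)⁻¹` … We readily deduce Theorem 6".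

This file PROVES that deduction with the twisted asymptotics as HYPOTHESES (they are Thm 25
specialised to characters `mod m` and no further local specification — Shintani zeta functions,
not in the tree — and are NOT vendored here):

* `sum_filter_modEq_eq_sum_char` — orthogonality: for `(a, m) = 1`, any finset `S ⊂ ℤ` and
  weight `w`, `Σ_{D ∈ S, D ≡ a (m)} w(D) = φ(m)⁻¹ Σ_{χ mod m} χ(ā⁻¹) Σ_{D ∈ S} χ(D̄) w(D)`
  (Mathlib's `DirichletCharacter.sum_char_inv_mul_char_eq`);
* `two_term_progression_of_twisted` — bookkeeping: if `Σ_{D ∈ S X} χ₀(D) w(D) = A X + K₀ X^{5/6} + O_ε(X^{θ+ε})`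
  for the trivial character and `Σ_{D ∈ S X} χ(D) w(D) = K_χ X^{5/6} + O_ε(X^{θ+ε})` for `χ ≠ χ₀`,
  then `Σ_{D ∈ S X, D ≡ a (m)} w(D) = (A/φ(m)) X + K X^{5/6} + O_ε(X^{θ+ε})`
  with `K = Re(φ(m)⁻¹ Σ_χ χ(ā⁻¹) K_χ)`;
* `totient_inv_mul_prod_eq` — the constant: `φ(m)⁻¹ Π_{p ∣ m} (1 + p⁻¹)⁻¹ = m⁻¹ Π_{p ∣ m} (1 - p⁻²)⁻¹`
  (Euler's product for `φ`), which is the printed `C'₁(m, a) = (1/m) Π_{p ∣ m} (1 - p⁻²)⁻¹`: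
  the trivial character `mod m` counts the fields with discriminant prime to `m`, of density
  `Π_{p ∣ m} (1 + p⁻¹)⁻¹` (unramified types have total normalised density `1/(1 + p⁻¹)`);
* `tt_threeTorsion_sum_progression_neg_of_twisted`, `…_pos_of_twisted`,
  `tt_threeTorsion_sum_progression_of_twisted` — **the deduction of Thm 6**: the twisted two-term
  asymptotics for `Σ_{0<±D<X} χ(D) c(D)`, `χ (mod m)`, `(m, 6) = 1` (main term
  `δ(χ) (C^±/(2π²)) Π_{p ∣ m} (1 + p⁻¹)⁻¹ X`, `C⁻ = 3`, `C⁺ = 1`, error `O_ε(X^{18/23+ε})`), for a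
  `c` with `#Cl₃ = 2c + 1`, imply the named fact `tt_threeTorsion_sum_progression`.

## References

* T. Taniguchi, F. Thorne, *Secondary terms in counting functions for cubic fields*, Duke Math.
  J. 162 (2013) 2451–2508 = arXiv:1102.2914, §6.4 (orthogonality display), Thm 25 and §6.6
  (displays for `M₃^±(X; m, a)`, `C'₁(m, a)`; "We readily deduce Theorem 6") [TaniguchiThorne2013].

## Mathlib search

`DirichletCharacter.sum_char_inv_mul_char_eq`, `DirichletCharacter.norm_le_one`,
`ZMod.coe_int_isUnit_iff_isCoprime`, `ZMod.intCast_eq_intCast_iff`, `ZMod.inv_mul_of_unit`,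
`MulChar.one_apply`, `Nat.totient_eq_mul_prod_factors`, `Complex.abs_re_le_norm`.
-/

noncomputable section

open Finset

namespace Literature.NumberTheory.QuadraticFields

/-! ### Orthogonality: the progression `a (mod m)` through the characters `mod m` (§6.4) -/

/-- For `(a, m) = 1` the class of `a` is a unit of `ZMod m`. [folklore] -/
theorem isUnit_intCast_zmod_of_isCoprime {m : ℕ} {a : ℤ} (ha : IsCoprime a m) :
    IsUnit ((a : ZMod m)) :=
  (ZMod.coe_int_isUnit_iff_isCoprime a m).2 ha.symm

/-- **Orthogonality (Taniguchi–Thorne §6.4, "the usual orthogonality relation").** For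
`(a, m) = 1`, a finset `S` of integers and a weight `w : ℤ → ℂ`,
`Σ_{D ∈ S, D ≡ a (mod m)} w(D) = φ(m)⁻¹ Σ_{χ (mod m)} χ(ā⁻¹) Σ_{D ∈ S} χ(D̄) w(D)`
(in print `N₃^±(X; m, a) = φ(m)⁻¹ Σ_χ χ̄(a) N₃^±(X, χ)`; `χ̄(a) = χ(a)⁻¹ = χ(ā⁻¹)` for a unit `ā`).
[cite: TaniguchiThorne2013, §6.4 (orthogonality relation for N₃^±(X; m, a))] -/
theorem sum_filter_modEq_eq_sum_char {m : ℕ} [NeZero m] {a : ℤ} (ha : IsCoprime a m)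
    (S : Finset ℤ) (w : ℤ → ℂ) :
    ∑ D ∈ S.filter (fun D => D ≡ a [ZMOD m]), w D =
      (m.totient : ℂ)⁻¹ * ∑ χ : DirichletCharacter ℂ m,
        χ (a : ZMod m)⁻¹ * ∑ D ∈ S, χ (D : ZMod m) * w D := by
  classical
  have hu : IsUnit ((a : ZMod m)) := isUnit_intCast_zmod_of_isCoprime ha
  have hφ : (m.totient : ℂ) ≠ 0 := by
    exact_mod_cast (Nat.totient_pos.2 (NeZero.pos m)).ne'
  -- swap the sums
  have hswap : ∑ χ : DirichletCharacter ℂ m, χ (a : ZMod m)⁻¹ * ∑ D ∈ S, χ (D : ZMod m) * w D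
      = ∑ D ∈ S, (∑ χ : DirichletCharacter ℂ m, χ (a : ZMod m)⁻¹ * χ (D : ZMod m)) * w D := by
    have : ∀ χ : DirichletCharacter ℂ m, χ (a : ZMod m)⁻¹ * ∑ D ∈ S, χ (D : ZMod m) * w D
        = ∑ D ∈ S, (χ (a : ZMod m)⁻¹ * χ (D : ZMod m)) * w D := fun χ => by
      rw [Finset.mul_sum]
      simp_rw [mul_assoc]
    simp_rw [this]
    rw [Finset.sum_comm]
    simp_rw [← Finset.sum_mul]
  rw [hswap, Finset.mul_sum, Finset.sum_filter]
  refine Finset.sum_congr rfl fun D _ => ?_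
  rw [DirichletCharacter.sum_char_inv_mul_char_eq ℂ hu]
  by_cases hD : D ≡ a [ZMOD m]
  · have : (a : ZMod m) = (D : ZMod m) := (ZMod.intCast_eq_intCast_iff a D m).2 hD.symm
    rw [if_pos this, if_pos hD, ← mul_assoc, inv_mul_cancel₀ hφ, one_mul]
  · have : (a : ZMod m) ≠ (D : ZMod m) := fun h =>
      hD ((ZMod.intCast_eq_intCast_iff a D m).1 h).symm
    rw [if_neg this, if_neg hD, zero_mul, mul_zero]

/-! ### From twisted two-term asymptotics to the progression (§6.6) -/

/-- **Bookkeeping behind "we readily deduce Theorem 6" (Taniguchi–Thorne §6.6).** Let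
`(a, m) = 1`, `w : ℤ → ℝ`, and suppose the twisted sums over the finsets `S X` satisfy
`Σ_{D ∈ S X} χ₀(D̄) w(D) = A X + K₀ X^{5/6} + O_ε(X^{θ+ε})` for the trivial character `χ₀ (mod m)`
and `Σ_{D ∈ S X} χ(D̄) w(D) = K_χ X^{5/6} + O_ε(X^{θ+ε})` for every `χ ≠ χ₀` (`K_χ ∈ ℂ`). Then
`Σ_{D ∈ S X, D ≡ a (m)} w(D) = (A/φ(m)) X + K X^{5/6} + O_ε(X^{θ+ε})` with
`K = Re(φ(m)⁻¹ Σ_χ χ(ā⁻¹) K_χ)` (orthogonality, `|χ(ā⁻¹)| ≤ 1`, `|Re z| ≤ |z|`). [folklore] -/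
theorem two_term_progression_of_twisted {S : ℕ → Finset ℤ} {w : ℤ → ℝ} {m : ℕ} [NeZero m]
    {a : ℤ} (ha : IsCoprime a m) {A θ : ℝ}
    (h1 : ∃ K : ℂ, ∀ ε : ℝ, 0 < ε → ∃ C : ℝ, ∀ X : ℕ, 1 ≤ X →
      ‖(∑ D ∈ S X, (1 : DirichletCharacter ℂ m) (D : ZMod m) * (w D : ℂ)) - ((A * X : ℝ) : ℂ)
          - K * (((X : ℝ) ^ ((5 : ℝ) / 6) : ℝ) : ℂ)‖ ≤ C * (X : ℝ) ^ (θ + ε))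
    (hχ : ∀ χ : DirichletCharacter ℂ m, χ ≠ 1 → ∃ K : ℂ, ∀ ε : ℝ, 0 < ε → ∃ C : ℝ,
      ∀ X : ℕ, 1 ≤ X →
        ‖(∑ D ∈ S X, χ (D : ZMod m) * (w D : ℂ))
            - K * (((X : ℝ) ^ ((5 : ℝ) / 6) : ℝ) : ℂ)‖ ≤ C * (X : ℝ) ^ (θ + ε)) :
    ∃ K : ℝ, ∀ ε : ℝ, 0 < ε → ∃ C : ℝ, ∀ X : ℕ, 1 ≤ X →
      |(∑ D ∈ (S X).filter (fun D => D ≡ a [ZMOD m]), w D) - A / m.totient * X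
          - K * (X : ℝ) ^ ((5 : ℝ) / 6)| ≤ C * (X : ℝ) ^ (θ + ε) := by
  classical
  -- the two hypotheses as one, with the main term `δ(χ) A X`
  have h : ∀ χ : DirichletCharacter ℂ m, ∃ K : ℂ, ∀ ε : ℝ, 0 < ε → ∃ C : ℝ, ∀ X : ℕ, 1 ≤ X →
      ‖(∑ D ∈ S X, χ (D : ZMod m) * (w D : ℂ)) - (if χ = 1 then ((A * X : ℝ) : ℂ) else 0)
          - K * (((X : ℝ) ^ ((5 : ℝ) / 6) : ℝ) : ℂ)‖ ≤ C * (X : ℝ) ^ (θ + ε) := by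
    intro χ
    by_cases hχ1 : χ = 1
    · subst hχ1
      simpa only [if_true] using h1
    · simpa only [hχ1, if_false, sub_zero] using hχ χ hχ1
  choose K hK using h
  have hu : IsUnit ((a : ZMod m)) := isUnit_intCast_zmod_of_isCoprime ha
  have hu' : IsUnit ((a : ZMod m)⁻¹) :=
    IsUnit.of_mul_eq_one _ (ZMod.inv_mul_of_unit _ hu)
  have hφpos : (0 : ℝ) < m.totient := by exact_mod_cast Nat.totient_pos.2 (NeZero.pos m)
  set Kc : ℂ := (m.totient : ℂ)⁻¹ *
    ∑ χ : DirichletCharacter ℂ m, χ (a : ZMod m)⁻¹ * K χ with hKc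
  refine ⟨Kc.re, fun ε hε => ?_⟩
  choose C hC using fun χ => hK χ ε hε
  refine ⟨(m.totient : ℝ)⁻¹ * ∑ χ : DirichletCharacter ℂ m, C χ, fun X hX => ?_⟩
  -- the error terms `E χ`
  set E : DirichletCharacter ℂ m → ℂ := fun χ =>
    (∑ D ∈ S X, χ (D : ZMod m) * (w D : ℂ)) - (if χ = 1 then ((A * X : ℝ) : ℂ) else 0)
      - K χ * (((X : ℝ) ^ ((5 : ℝ) / 6) : ℝ) : ℂ) with hE
  -- orthogonality and the main term
  have horth := sum_filter_modEq_eq_sum_char ha (S X) (fun D => (w D : ℂ))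
  have hmain : ∑ χ : DirichletCharacter ℂ m,
      χ (a : ZMod m)⁻¹ * (if χ = 1 then ((A * X : ℝ) : ℂ) else 0) = ((A * X : ℝ) : ℂ) := by
    rw [Finset.sum_eq_single (1 : DirichletCharacter ℂ m)]
    · rw [if_pos rfl, MulChar.one_apply hu', one_mul]
    · intro χ _ hχ1
      rw [if_neg hχ1, mul_zero]
    · intro h
      exact absurd (Finset.mem_univ _) h
  -- the complexified quantity is `φ(m)⁻¹ Σ_χ χ(ā⁻¹) E χ`
  have hZ : ((((∑ D ∈ (S X).filter (fun D => D ≡ a [ZMOD m]), w D) - A / m.totient * X : ℝ)) : ℂ)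
      - Kc * (((X : ℝ) ^ ((5 : ℝ) / 6) : ℝ) : ℂ)
      = (m.totient : ℂ)⁻¹ * ∑ χ : DirichletCharacter ℂ m, χ (a : ZMod m)⁻¹ * E χ := by
    have h3 : ∑ χ : DirichletCharacter ℂ m, χ (a : ZMod m)⁻¹ * E χ =
        (∑ χ : DirichletCharacter ℂ m, χ (a : ZMod m)⁻¹ * ∑ D ∈ S X, χ (D : ZMod m) * (w D : ℂ))
          - ((A * X : ℝ) : ℂ)
          - (∑ χ : DirichletCharacter ℂ m, χ (a : ZMod m)⁻¹ * K χ)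
              * (((X : ℝ) ^ ((5 : ℝ) / 6) : ℝ) : ℂ) := by
      rw [← hmain]
      simp only [hE, mul_sub, Finset.sum_sub_distrib, Finset.sum_mul, mul_assoc]
    rw [h3, mul_sub, mul_sub, ← horth, hKc]
    push_cast
    ring
  -- real part and the triangle inequality
  have hre : (∑ D ∈ (S X).filter (fun D => D ≡ a [ZMOD m]), w D) - A / m.totient * X
      - Kc.re * (X : ℝ) ^ ((5 : ℝ) / 6) =
      (((((∑ D ∈ (S X).filter (fun D => D ≡ a [ZMOD m]), w D) - A / m.totient * X : ℝ)) : ℂ)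
        - Kc * (((X : ℝ) ^ ((5 : ℝ) / 6) : ℝ) : ℂ)).re := by
    simp only [Complex.sub_re, Complex.ofReal_re, Complex.mul_re, Complex.ofReal_im,
      mul_zero, sub_zero]
  rw [hre, hZ]
  refine (Complex.abs_re_le_norm _).trans ?_
  rw [norm_mul, norm_inv, Complex.norm_natCast, mul_assoc]
  refine mul_le_mul_of_nonneg_left ?_ (inv_nonneg.2 hφpos.le)
  refine (norm_sum_le _ _).trans ?_
  rw [Finset.sum_mul]
  refine Finset.sum_le_sum fun χ _ => ?_
  rw [norm_mul]
  calc ‖χ (a : ZMod m)⁻¹‖ * ‖E χ‖ ≤ 1 * ‖E χ‖ :=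
        mul_le_mul_of_nonneg_right (DirichletCharacter.norm_le_one χ _) (norm_nonneg _)
    _ = ‖E χ‖ := one_mul _
    _ ≤ C χ * (X : ℝ) ^ (θ + ε) := hC χ X hX

/-! ### The constant `C'₁(m, a) = (1/m) Π_{p ∣ m} (1 - p⁻²)⁻¹` (§6.6) -/

/-- **Taniguchi–Thorne §6.6: `C'₁(m, a) = (1/m) Π_{p ∣ m} (1 - p⁻²)⁻¹`.** The density supplied by
the trivial character `mod m` (fields with discriminant prime to `m`: local factor
`(1 + p⁻¹)⁻¹` at each `p ∣ m`, the normalisation "dividing by `1 + p⁻¹`" of §6.3/§6.6) divided by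
`φ(m)` is the printed constant: `φ(m)⁻¹ Π_{p ∣ m} (1 + p⁻¹)⁻¹ = m⁻¹ Π_{p ∣ m} (1 - p⁻²)⁻¹`, by
Euler's product `φ(m) = m Π_{p ∣ m} (1 - p⁻¹)` and `(1 - p⁻¹)(1 + p⁻¹) = 1 - p⁻²`.
[cite: TaniguchiThorne2013, §6.6 (formula for C'₁(m, a))] -/
theorem totient_inv_mul_prod_eq {m : ℕ} (hm : m ≠ 0) :
    (m.totient : ℝ)⁻¹ * ∏ p ∈ m.primeFactors, (1 + 1 / (p : ℝ))⁻¹ =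
      (m : ℝ)⁻¹ * ∏ p ∈ m.primeFactors, (1 - 1 / (p : ℝ) ^ 2)⁻¹ := by
  have hφ : (m.totient : ℝ) = m * ∏ p ∈ m.primeFactors, (1 - 1 / (p : ℝ)) := by
    have h := congrArg (Rat.cast : ℚ → ℝ) (Nat.totient_eq_mul_prod_factors m)
    push_cast at h
    simpa only [one_div] using h
  have hm' : (m : ℝ) ≠ 0 := by exact_mod_cast hm
  rw [hφ, mul_inv, mul_assoc]
  congr 1
  rw [← Finset.prod_inv_distrib, ← Finset.prod_mul_distrib]
  refine Finset.prod_congr rfl fun p hp => ?_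
  have hp1 : (1 : ℝ) < p := by exact_mod_cast (Nat.prime_of_mem_primeFactors hp).one_lt
  have hp0 : (p : ℝ) ≠ 0 := by positivity
  have hpm1 : (p : ℝ) - 1 ≠ 0 := by linarith
  have hpp1 : (p : ℝ) + 1 ≠ 0 := by positivity
  rw [← mul_inv]
  congr 1
  field_simp
  ring

/-! ### "We readily deduce Theorem 6" -/

/-- `gcd(6a, m) = 1` gives `gcd(m, 6) = 1`. [folklore] -/
theorem coprime_six_of_gcd_six_mul {m : ℕ} {a : ℤ} (h : Int.gcd (6 * a) m = 1) :
    m.Coprime 6 := by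
  have h6a : IsCoprime (6 * a) (m : ℤ) := Int.isCoprime_iff_gcd_eq_one.2 h
  have h6 : IsCoprime ((6 : ℕ) : ℤ) (m : ℤ) := by simpa using h6a.of_mul_left_left
  exact (Nat.isCoprime_iff_coprime.1 h6).symm

/-- **Thm 6, imaginary side, from the twisted asymptotics (Taniguchi–Thorne §6.6).** Let
`(6a, m) = 1`, let `c : ℤ → ℕ` satisfy `#Cl₃(D) = 2·c(D) + 1` on negative fundamental
discriminants (in print: `c(D)` = the number of nowhere totally ramified cubic fields of
discriminant `D`; Hasse, §6.1), and assume Theorem 25 of the paper for the characters `mod m`: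
`Σ_{-X<D<0} χ₀(D) c(D) = (3/(2π²)) Π_{p ∣ m} (1 + p⁻¹)⁻¹ X + K₀ X^{5/6} + O_ε(X^{18/23+ε})` for
the trivial character and `Σ_{-X<D<0} χ(D) c(D) = K_χ X^{5/6} + O_ε(X^{18/23+ε})` for `χ ≠ χ₀`
(`C⁻ = 3`; `K_χ = 0` unless `χ⁶ = 1`). Then the imaginary half of `tt_threeTorsion_sum_progression`
holds at `(m, a)`: `Σ_{-X<D<0, D ≡ a (m)} #Cl₃(D) = (6/(π² m)) Π_{p ∣ m} (1 - p⁻²)⁻¹ X + K X^{5/6} + O_ε(X^{18/23+ε})`.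
[cite: TaniguchiThorne2013, §6.6 (deduction of Theorem 6 from Theorem 25)] -/
theorem tt_threeTorsion_sum_progression_neg_of_twisted {m : ℕ} {a : ℤ}
    (h : Int.gcd (6 * a) m = 1) {c : ℤ → ℕ}
    (hc : ∀ X : ℕ, ∀ D ∈ negFundDiscrs X, quadFieldThreeTorsion D = 2 * c D + 1)
    (h1 : ∃ K : ℂ, ∀ ε : ℝ, 0 < ε → ∃ C : ℝ, ∀ X : ℕ, 1 ≤ X →
      ‖(∑ D ∈ negFundDiscrs X, (1 : DirichletCharacter ℂ m) (D : ZMod m) * (c D : ℂ))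
          - ((3 / (2 * Real.pi ^ 2) * (∏ p ∈ m.primeFactors, (1 + 1 / (p : ℝ))⁻¹) * X : ℝ) : ℂ)
          - K * (((X : ℝ) ^ ((5 : ℝ) / 6) : ℝ) : ℂ)‖ ≤ C * (X : ℝ) ^ ((18 : ℝ) / 23 + ε))
    (hχ : ∀ χ : DirichletCharacter ℂ m, χ ≠ 1 → ∃ K : ℂ, ∀ ε : ℝ, 0 < ε → ∃ C : ℝ,
      ∀ X : ℕ, 1 ≤ X →
        ‖(∑ D ∈ negFundDiscrs X, χ (D : ZMod m) * (c D : ℂ))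
            - K * (((X : ℝ) ^ ((5 : ℝ) / 6) : ℝ) : ℂ)‖ ≤ C * (X : ℝ) ^ ((18 : ℝ) / 23 + ε)) :
    ∃ K : ℝ, ∀ ε : ℝ, 0 < ε → ∃ C : ℝ, ∀ X : ℕ, 1 ≤ X →
      |(∑ D ∈ (negFundDiscrs X).filter (fun D => D ≡ a [ZMOD m]), (quadFieldThreeTorsion D : ℝ))
          - 6 / (Real.pi ^ 2 * m) * (∏ p ∈ m.primeFactors, (1 - 1 / (p : ℝ) ^ 2)⁻¹) * X
          - K * (X : ℝ) ^ ((5 : ℝ) / 6)| ≤ C * (X : ℝ) ^ ((18 : ℝ) / 23 + ε) := by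
  have hm0 : m ≠ 0 := by
    have := Nat.odd_iff.1 (odd_and_gcd_eq_one_of_gcd_six_mul h).1
    omega
  haveI : NeZero m := ⟨hm0⟩
  have ha : IsCoprime a m :=
    Int.isCoprime_iff_gcd_eq_one.2 (odd_and_gcd_eq_one_of_gcd_six_mul h).2
  -- the abstract deduction, for the weight `w = c`
  have key := two_term_progression_of_twisted (S := negFundDiscrs) (w := fun D => (c D : ℝ))
    (θ := (18 : ℝ) / 23) ha (by simpa only [Complex.ofReal_natCast] using h1)
    (by simpa only [Complex.ofReal_natCast] using hχ)
  -- the constant `C'₁(m, a) C⁻/(2π²)`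
  have hconst : 3 / (2 * Real.pi ^ 2) * (∏ p ∈ m.primeFactors, (1 + 1 / (p : ℝ))⁻¹)
      / (m.totient : ℝ) = 3 / (2 * Real.pi ^ 2 * m)
        * ∏ p ∈ m.primeFactors, (1 - 1 / (p : ℝ) ^ 2)⁻¹ := by
    calc 3 / (2 * Real.pi ^ 2) * (∏ p ∈ m.primeFactors, (1 + 1 / (p : ℝ))⁻¹) / (m.totient : ℝ)
        = 3 / (2 * Real.pi ^ 2) *
            ((m.totient : ℝ)⁻¹ * ∏ p ∈ m.primeFactors, (1 + 1 / (p : ℝ))⁻¹) := by ring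
      _ = 3 / (2 * Real.pi ^ 2) *
            ((m : ℝ)⁻¹ * ∏ p ∈ m.primeFactors, (1 - 1 / (p : ℝ) ^ 2)⁻¹) := by
          rw [totient_inv_mul_prod_eq hm0]
      _ = 3 / (2 * Real.pi ^ 2 * m) * ∏ p ∈ m.primeFactors, (1 - 1 / (p : ℝ) ^ 2)⁻¹ := by
          ring
  obtain ⟨K, hK⟩ := key
  refine (tt_threeTorsion_sum_progression_neg_iff_cubicCount h hc).2 ⟨K, fun ε hε => ?_⟩
  obtain ⟨C, hC⟩ := hK ε hε
  refine ⟨C, fun X hX => ?_⟩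
  have := hC X hX
  rwa [hconst] at this

/-- **Thm 6, real side, from the twisted asymptotics (Taniguchi–Thorne §6.6).** As
`tt_threeTorsion_sum_progression_neg_of_twisted`, over positive fundamental discriminants, with
`C⁺ = 1`: twisted main term `(1/(2π²)) Π_{p ∣ m} (1 + p⁻¹)⁻¹ X` for the trivial character, and
conclusion `Σ_{0<D<X, D ≡ a (m)} #Cl₃(D) = (4/(π² m)) Π_{p ∣ m} (1 - p⁻²)⁻¹ X + K X^{5/6} + O_ε(X^{18/23+ε})`.
[cite: TaniguchiThorne2013, §6.6 (deduction of Theorem 6 from Theorem 25)] -/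
theorem tt_threeTorsion_sum_progression_pos_of_twisted {m : ℕ} {a : ℤ}
    (h : Int.gcd (6 * a) m = 1) {c : ℤ → ℕ}
    (hc : ∀ X : ℕ, ∀ D ∈ posFundDiscrs X, quadFieldThreeTorsion D = 2 * c D + 1)
    (h1 : ∃ K : ℂ, ∀ ε : ℝ, 0 < ε → ∃ C : ℝ, ∀ X : ℕ, 1 ≤ X →
      ‖(∑ D ∈ posFundDiscrs X, (1 : DirichletCharacter ℂ m) (D : ZMod m) * (c D : ℂ))
          - ((1 / (2 * Real.pi ^ 2) * (∏ p ∈ m.primeFactors, (1 + 1 / (p : ℝ))⁻¹) * X : ℝ) : ℂ)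
          - K * (((X : ℝ) ^ ((5 : ℝ) / 6) : ℝ) : ℂ)‖ ≤ C * (X : ℝ) ^ ((18 : ℝ) / 23 + ε))
    (hχ : ∀ χ : DirichletCharacter ℂ m, χ ≠ 1 → ∃ K : ℂ, ∀ ε : ℝ, 0 < ε → ∃ C : ℝ,
      ∀ X : ℕ, 1 ≤ X →
        ‖(∑ D ∈ posFundDiscrs X, χ (D : ZMod m) * (c D : ℂ))
            - K * (((X : ℝ) ^ ((5 : ℝ) / 6) : ℝ) : ℂ)‖ ≤ C * (X : ℝ) ^ ((18 : ℝ) / 23 + ε)) :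
    ∃ K : ℝ, ∀ ε : ℝ, 0 < ε → ∃ C : ℝ, ∀ X : ℕ, 1 ≤ X →
      |(∑ D ∈ (posFundDiscrs X).filter (fun D => D ≡ a [ZMOD m]), (quadFieldThreeTorsion D : ℝ))
          - 4 / (Real.pi ^ 2 * m) * (∏ p ∈ m.primeFactors, (1 - 1 / (p : ℝ) ^ 2)⁻¹) * X
          - K * (X : ℝ) ^ ((5 : ℝ) / 6)| ≤ C * (X : ℝ) ^ ((18 : ℝ) / 23 + ε) := by
  have hm0 : m ≠ 0 := by
    have := Nat.odd_iff.1 (odd_and_gcd_eq_one_of_gcd_six_mul h).1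
    omega
  haveI : NeZero m := ⟨hm0⟩
  have ha : IsCoprime a m :=
    Int.isCoprime_iff_gcd_eq_one.2 (odd_and_gcd_eq_one_of_gcd_six_mul h).2
  have key := two_term_progression_of_twisted (S := posFundDiscrs) (w := fun D => (c D : ℝ))
    (θ := (18 : ℝ) / 23) ha (by simpa only [Complex.ofReal_natCast] using h1)
    (by simpa only [Complex.ofReal_natCast] using hχ)
  have hconst : 1 / (2 * Real.pi ^ 2) * (∏ p ∈ m.primeFactors, (1 + 1 / (p : ℝ))⁻¹)
      / (m.totient : ℝ) = 1 / (2 * Real.pi ^ 2 * m)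
        * ∏ p ∈ m.primeFactors, (1 - 1 / (p : ℝ) ^ 2)⁻¹ := by
    calc 1 / (2 * Real.pi ^ 2) * (∏ p ∈ m.primeFactors, (1 + 1 / (p : ℝ))⁻¹) / (m.totient : ℝ)
        = 1 / (2 * Real.pi ^ 2) *
            ((m.totient : ℝ)⁻¹ * ∏ p ∈ m.primeFactors, (1 + 1 / (p : ℝ))⁻¹) := by ring
      _ = 1 / (2 * Real.pi ^ 2) *
            ((m : ℝ)⁻¹ * ∏ p ∈ m.primeFactors, (1 - 1 / (p : ℝ) ^ 2)⁻¹) := by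
          rw [totient_inv_mul_prod_eq hm0]
      _ = 1 / (2 * Real.pi ^ 2 * m) * ∏ p ∈ m.primeFactors, (1 - 1 / (p : ℝ) ^ 2)⁻¹ := by
          ring
  obtain ⟨K, hK⟩ := key
  refine (tt_threeTorsion_sum_progression_pos_iff_cubicCount h hc).2 ⟨K, fun ε hε => ?_⟩
  obtain ⟨C, hC⟩ := hK ε hε
  refine ⟨C, fun X hX => ?_⟩
  have := hC X hX
  rwa [hconst] at this

/-- **"We readily deduce Theorem 6" (Taniguchi–Thorne §6.6).** Let `c : ℤ → ℕ` satisfy the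
dictionary `#Cl₃(D) = 2·c(D) + 1` (Hasse, §6.1: `c(D)` = the number of nowhere totally ramified
cubic fields of discriminant `D`). Assume, for every modulus `m` prime to `6` and both signs, the
twisted two-term asymptotics of Theorem 25 for the characters `χ (mod m)`:
`Σ_{0<±D<X} χ(D) c(D) = δ(χ) (C^±/(2π²)) Π_{p ∣ m} (1 + p⁻¹)⁻¹ X + K^±_χ X^{5/6} + O_{m,ε}(X^{18/23+ε})`
(`C⁻ = 3`, `C⁺ = 1`, `δ(χ) = [χ = χ₀]`). Then the named fact
`tt_threeTorsion_sum_progression` (Thm 6: `Σ_{0<±D<X, D ≡ a (m)} #Cl₃(D) = ((3 + C^±)/(π² m)) Π_{p ∣ m} (1 - p⁻²)⁻¹ X + K X^{5/6} + O(X^{18/23+ε})`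
for `(6a, m) = 1`) holds — by orthogonality of characters, `C'₁(m, a) = (1/m) Π (1 - p⁻²)⁻¹`,
and `Σ #Cl₃ = Σ 1 + 2 M₃^±` with the proved count of fundamental discriminants in the class.
The hypotheses (Shintani zeta functions twisted by characters) are not in the tree.
[cite: TaniguchiThorne2013, §6.6 (deduction of Theorem 6 from Theorem 25)] -/
theorem tt_threeTorsion_sum_progression_of_twisted {c : ℤ → ℕ}
    (hc : ∀ D : ℤ, quadFieldThreeTorsion D = 2 * c D + 1)
    (hneg1 : ∀ m : ℕ, m.Coprime 6 → ∃ K : ℂ, ∀ ε : ℝ, 0 < ε → ∃ C : ℝ, ∀ X : ℕ, 1 ≤ X →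
      ‖(∑ D ∈ negFundDiscrs X, (1 : DirichletCharacter ℂ m) (D : ZMod m) * (c D : ℂ))
          - ((3 / (2 * Real.pi ^ 2) * (∏ p ∈ m.primeFactors, (1 + 1 / (p : ℝ))⁻¹) * X : ℝ) : ℂ)
          - K * (((X : ℝ) ^ ((5 : ℝ) / 6) : ℝ) : ℂ)‖ ≤ C * (X : ℝ) ^ ((18 : ℝ) / 23 + ε))
    (hneg : ∀ m : ℕ, m.Coprime 6 → ∀ χ : DirichletCharacter ℂ m, χ ≠ 1 → ∃ K : ℂ, ∀ ε : ℝ,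
      0 < ε → ∃ C : ℝ, ∀ X : ℕ, 1 ≤ X →
        ‖(∑ D ∈ negFundDiscrs X, χ (D : ZMod m) * (c D : ℂ))
            - K * (((X : ℝ) ^ ((5 : ℝ) / 6) : ℝ) : ℂ)‖ ≤ C * (X : ℝ) ^ ((18 : ℝ) / 23 + ε))
    (hpos1 : ∀ m : ℕ, m.Coprime 6 → ∃ K : ℂ, ∀ ε : ℝ, 0 < ε → ∃ C : ℝ, ∀ X : ℕ, 1 ≤ X →
      ‖(∑ D ∈ posFundDiscrs X, (1 : DirichletCharacter ℂ m) (D : ZMod m) * (c D : ℂ))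
          - ((1 / (2 * Real.pi ^ 2) * (∏ p ∈ m.primeFactors, (1 + 1 / (p : ℝ))⁻¹) * X : ℝ) : ℂ)
          - K * (((X : ℝ) ^ ((5 : ℝ) / 6) : ℝ) : ℂ)‖ ≤ C * (X : ℝ) ^ ((18 : ℝ) / 23 + ε))
    (hpos : ∀ m : ℕ, m.Coprime 6 → ∀ χ : DirichletCharacter ℂ m, χ ≠ 1 → ∃ K : ℂ, ∀ ε : ℝ,
      0 < ε → ∃ C : ℝ, ∀ X : ℕ, 1 ≤ X →
        ‖(∑ D ∈ posFundDiscrs X, χ (D : ZMod m) * (c D : ℂ))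
            - K * (((X : ℝ) ^ ((5 : ℝ) / 6) : ℝ) : ℂ)‖ ≤ C * (X : ℝ) ^ ((18 : ℝ) / 23 + ε)) :
    tt_threeTorsion_sum_progression := fun m _ _ h =>
  ⟨tt_threeTorsion_sum_progression_neg_of_twisted h (fun _ D _ => hc D)
      (hneg1 m (coprime_six_of_gcd_six_mul h)) (hneg m (coprime_six_of_gcd_six_mul h)),
    tt_threeTorsion_sum_progression_pos_of_twisted h (fun _ D _ => hc D)
      (hpos1 m (coprime_six_of_gcd_six_mul h)) (hpos m (coprime_six_of_gcd_six_mul h))⟩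

end Literature.NumberTheory.QuadraticFields

end
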